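import Mathlib.Analysis.Convex.Segment
import Mathlib.Analysis.Convex.Topology
import Mathlib.Topology.Connected.PathConnected
import Mathlib.Topology.MetricSpace.Thickening
import Mathlib.Topology.UniformSpace.HeineCantor
import Literature.Probability.LatticeModels.LatticeLoopWinding
import HarnessLib

/-!
# The trace of a closed lattice walk and the winding number of its faces along paths

For a closed nearest-neighbour walk `c : ClosedWalk n` on `ℤ²`
(`Literature.Probability.LatticeModels.LatticeLoopWinding`) we consider its **trace**
`c.trace ⊆ ℂ`, the union of the closed unit segments of its steps, and the face `flFace z =
(⌊re z⌋, ⌊im z⌋)` of the square lattice containing a point `z` (faces are labelled by their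
south-west corners, as in `ClosedWalk.W`).

The combinatorial winding number `c.W` is **locally constant off the trace**: across an edge
that is not a step of the walk it does not jump (`W_succ_fst` / `W_succ_snd` and the vanishing of
the flux through an untraversed edge), and the four faces around a lattice point that is not a
vertex of the walk carry the same value.  We turn this into statements about points of the
plane:

* `ClosedWalk.W_flFace_eq_of_segment` — if the closed segment `[z, w]` misses the trace and
  `|re z - re w| < 1`, `|im z - im w| < 1`, then `c.W (flFace z) = c.W (flFace w)`;
* `ClosedWalk.W_flFace_eq_of_path` / `…_of_joinedIn` — the same along any path missing the
  trace (uniform continuity and a positive distance from the compact trace);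
* `ClosedWalk.W_flFace_eq_zero_of_far` — far from the walk the winding number vanishes, so a face
  whose centre is joined off the trace to a far point has winding number zero
  (`ClosedWalk.W_eq_zero_of_joinedIn_far`).

This is the path-lifting-free half of the statement "`W f` is the topological winding number of
the polygon about the centre of `f`"; it is all that is needed to identify the faces enclosed by a
lattice polygon with the bounded complementary component.  [folklore]
-/

noncomputable section

open Set Metric Complex

namespace Literature.Probability.LatticeModels

/-- The lattice point `p ∈ ℤ²` as a complex number. [folklore] -/
def latC (p : ℤ × ℤ) : ℂ := ⟨p.1, p.2⟩

/-- [folklore] -/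
@[simp] theorem latC_re (p : ℤ × ℤ) : (latC p).re = p.1 := rfl
/-- [folklore] -/
@[simp] theorem latC_im (p : ℤ × ℤ) : (latC p).im = p.2 := rfl

/-- [folklore] -/
theorem latC_injective : Function.Injective latC := by
  intro p q h
  have h1 := congrArg Complex.re h
  have h2 := congrArg Complex.im h
  simp only [latC_re, latC_im, Int.cast_inj] at h1 h2
  exact Prod.ext h1 h2

/-- The face of the square lattice (labelled by its south-west corner) whose half-open cell
`[p, p + 1) × [q, q + 1)` contains `z`. [folklore] -/
def flFace (z : ℂ) : ℤ × ℤ := (⌊z.re⌋, ⌊z.im⌋)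

/-- The centre of the face `f`. [folklore] -/
def faceCtr (f : ℤ × ℤ) : ℂ := ⟨f.1 + 1 / 2, f.2 + 1 / 2⟩

/-- [folklore] -/
@[simp] theorem faceCtr_re (f : ℤ × ℤ) : (faceCtr f).re = f.1 + 1 / 2 := rfl
/-- [folklore] -/
@[simp] theorem faceCtr_im (f : ℤ × ℤ) : (faceCtr f).im = f.2 + 1 / 2 := rfl

/-- [folklore] -/
theorem flFace_faceCtr (f : ℤ × ℤ) : flFace (faceCtr f) = f := by
  obtain ⟨p, q⟩ := f
  simp only [flFace, faceCtr_re, faceCtr_im, Prod.mk.injEq]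
  constructor <;> (rw [Int.floor_eq_iff]; constructor <;> linarith)

/-- [folklore] -/
theorem flFace_latC (p : ℤ × ℤ) : flFace (latC p) = p := by
  simp [flFace]

/-! ### Points of unit lattice segments -/

/-- Membership in the vertical unit segment above the lattice point `(a, b)`. [folklore] -/
theorem mem_segment_latC_up_iff {a b : ℤ} {z : ℂ} :
    z ∈ segment ℝ (latC (a, b)) (latC (a, b + 1)) ↔ z.re = a ∧ (b : ℝ) ≤ z.im ∧ z.im ≤ b + 1 := by
  constructor
  · rintro ⟨s, t, hs, ht, hst, rfl⟩
    obtain rfl : s = 1 - t := eq_sub_of_add_eq hst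
    simp only [add_re, smul_re, latC_re, smul_eq_mul, add_im, smul_im, latC_im, Int.cast_add,
      Int.cast_one]
    refine ⟨by ring, by nlinarith, by nlinarith⟩
  · rintro ⟨hre, h1, h2⟩
    refine ⟨b + 1 - z.im, z.im - b, by linarith, by linarith, by ring, ?_⟩
    apply Complex.ext <;>
      simp only [add_re, smul_re, latC_re, smul_eq_mul, add_im, smul_im, latC_im, Int.cast_add,
        Int.cast_one] <;> [linarith; ring]

/-- Membership in the horizontal unit segment to the right of the lattice point `(a, b)`. [folklore] -/
theorem mem_segment_latC_right_iff {a b : ℤ} {z : ℂ} :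
    z ∈ segment ℝ (latC (a, b)) (latC (a + 1, b)) ↔ z.im = b ∧ (a : ℝ) ≤ z.re ∧ z.re ≤ a + 1 := by
  constructor
  · rintro ⟨s, t, hs, ht, hst, rfl⟩
    obtain rfl : s = 1 - t := eq_sub_of_add_eq hst
    simp only [add_re, smul_re, latC_re, smul_eq_mul, add_im, smul_im, latC_im, Int.cast_add,
      Int.cast_one]
    refine ⟨by ring, by nlinarith, by nlinarith⟩
  · rintro ⟨him, h1, h2⟩
    refine ⟨a + 1 - z.re, z.re - a, by linarith, by linarith, by ring, ?_⟩
    apply Complex.ext <;>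
      simp only [add_re, smul_re, latC_re, smul_eq_mul, add_im, smul_im, latC_im, Int.cast_add,
        Int.cast_one] <;> [ring; linarith]

namespace ClosedWalk

variable {n : ℕ} (c : ClosedWalk n)

/-- The **trace** of a closed lattice walk: the union of the closed segments of its steps. [folklore] -/
def trace : Set ℂ := ⋃ j ∈ Finset.range n, segment ℝ (latC (c.v j)) (latC (c.v (j + 1)))

/-- [folklore] -/
theorem segment_subset_trace {j : ℕ} (hj : j < n) :
    segment ℝ (latC (c.v j)) (latC (c.v (j + 1))) ⊆ c.trace := by
  intro z hz
  exact Set.mem_iUnion₂.2 ⟨j, Finset.mem_range.2 hj, hz⟩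

/-- [folklore] -/
theorem mem_trace_iff {z : ℂ} :
    z ∈ c.trace ↔ ∃ j < n, z ∈ segment ℝ (latC (c.v j)) (latC (c.v (j + 1))) := by
  simp only [trace, Set.mem_iUnion₂, Finset.mem_range, exists_prop]

/-- [folklore] -/
theorem latC_v_mem_trace (hn : 0 < n) (j : ℕ) : latC (c.v j) ∈ c.trace := by
  rw [← c.v_mod j]
  exact c.segment_subset_trace (Nat.mod_lt j hn) (left_mem_segment _ _ _)

/-- [folklore] -/
theorem isCompact_trace : IsCompact c.trace :=
  (Finset.range n).isCompact_biUnion fun j _ => by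
    rw [segment_eq_image_lineMap]
    exact isCompact_Icc.image AffineMap.lineMap_continuous

/-- [folklore] -/
theorem isClosed_trace : IsClosed c.trace := c.isCompact_trace.isClosed

/-- A lattice point off the trace is not a vertex of the walk. [folklore] -/
theorem v_ne_of_latC_not_mem (hn : 0 < n) {u : ℤ × ℤ} (hu : latC u ∉ c.trace) (j : ℕ) :
    c.v j ≠ u := fun h => hu (h ▸ c.latC_v_mem_trace hn j)

/-- A directed lattice edge whose segment contains a point off the trace is not traversed. [folklore] -/
theorem cnt_eq_zero_of_not_mem_trace {P Q : ℤ × ℤ} {ζ : ℂ}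
    (hζ : ζ ∈ segment ℝ (latC P) (latC Q)) (hζt : ζ ∉ c.trace) : c.cnt P Q = 0 := by
  unfold cnt
  refine Finset.sum_eq_zero fun j hj => indZ_of_neg ?_
  rintro ⟨hP, hQ⟩
  refine hζt (c.segment_subset_trace (Finset.mem_range.1 hj) ?_)
  rwa [hP, hQ]

/-- No jump of `W` across a vertical edge containing a point off the trace. [folklore] -/
theorem W_east_eq {a b : ℤ} {ζ : ℂ} (hζ : ζ ∈ segment ℝ (latC (a + 1, b)) (latC (a + 1, b + 1)))
    (hζt : ζ ∉ c.trace) : c.W (a + 1, b) = c.W (a, b) := by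
  have hζ' : ζ ∈ segment ℝ (latC (a + 1, b + 1)) (latC (a + 1, b)) := by rwa [segment_symm]
  rw [c.W_succ_fst, cV_eq_cnt, c.cnt_eq_zero_of_not_mem_trace hζ hζt,
    c.cnt_eq_zero_of_not_mem_trace hζ' hζt]
  ring

/-- No jump of `W` across a horizontal edge containing a point off the trace. [folklore] -/
theorem W_north_eq {a b : ℤ} {ζ : ℂ} (hζ : ζ ∈ segment ℝ (latC (a, b + 1)) (latC (a + 1, b + 1)))
    (hζt : ζ ∉ c.trace) : c.W (a, b + 1) = c.W (a, b) := by
  have hζ' : ζ ∈ segment ℝ (latC (a + 1, b + 1)) (latC (a, b + 1)) := by rwa [segment_symm]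
  rw [c.W_succ_snd, cH_eq_cnt, c.cnt_eq_zero_of_not_mem_trace hζ hζt,
    c.cnt_eq_zero_of_not_mem_trace hζ' hζt]
  ring

/-- Around a lattice point off the trace the four faces have the same winding number. [folklore] -/
theorem W_around_eq_of_latC_not_mem (hn : 0 < n) {a b : ℤ} (hu : latC (a, b) ∉ c.trace) :
    c.W (a - 1, b) = c.W (a, b) ∧ c.W (a, b - 1) = c.W (a, b) ∧ c.W (a - 1, b - 1) = c.W (a, b) := by
  have h := c.v_ne_of_latC_not_mem hn hu
  have h1 : c.W (a - 1, b) = c.W (a, b) := by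
    have := c.W_succ_fst (a - 1) b
    rw [sub_add_cancel, c.cV_eq_zero_of_lower h, sub_zero] at this
    exact this.symm
  have h2 : c.W (a, b - 1) = c.W (a, b) := by
    have := c.W_succ_snd a (b - 1)
    rw [sub_add_cancel, c.cH_eq_zero_of_left h, add_zero] at this
    exact this.symm
  have h3 : c.W (a - 1, b - 1) = c.W (a, b - 1) := by
    have := c.W_succ_fst (a - 1) (b - 1)
    rw [sub_add_cancel, c.cV_eq_zero_of_upper (by rw [sub_add_cancel]; exact h), sub_zero] at this
    exact this.symm
  exact ⟨h1, h2, h3.trans h2⟩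

end ClosedWalk

/-! ### Crossing points of a segment with a vertical or horizontal line -/

/-- [folklore] -/
theorem exists_mem_segment_re_eq {p q : ℂ} {s : ℝ} (h1 : p.re ≤ s) (h2 : s ≤ q.re) :
    ∃ ζ ∈ segment ℝ p q, ζ.re = s ∧ min p.im q.im ≤ ζ.im ∧ ζ.im ≤ max p.im q.im := by
  rcases eq_or_lt_of_le (h1.trans h2) with hpq | hpq
  · refine ⟨p, left_mem_segment ℝ p q, le_antisymm h1 (hpq ▸ h2), min_le_left _ _, le_max_left _ _⟩
  set l : ℝ := (s - p.re) / (q.re - p.re) with hl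
  have hd : 0 < q.re - p.re := by linarith
  have hl0 : 0 ≤ l := div_nonneg (by linarith) hd.le
  have hl1 : l ≤ 1 := div_le_one_of_le₀ (by linarith) hd.le
  refine ⟨p + l • (q - p), ⟨1 - l, l, by linarith, hl0, by ring, by
    simp only [sub_smul, one_smul, smul_sub]; abel⟩, ?_, ?_, ?_⟩
  · simp only [add_re, smul_re, sub_re, smul_eq_mul, hl]
    field_simp
    ring
  · simp only [add_im, smul_im, sub_im, smul_eq_mul]
    rcases le_total p.im q.im with h | h
    · rw [min_eq_left h]; nlinarith
    · rw [min_eq_right h]; nlinarith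
  · simp only [add_im, smul_im, sub_im, smul_eq_mul]
    rcases le_total p.im q.im with h | h
    · rw [max_eq_right h]; nlinarith
    · rw [max_eq_left h]; nlinarith

/-- [folklore] -/
theorem exists_mem_segment_re_eq' {p q : ℂ} {s : ℝ} (h1 : q.re ≤ s) (h2 : s ≤ p.re) :
    ∃ ζ ∈ segment ℝ p q, ζ.re = s ∧ min p.im q.im ≤ ζ.im ∧ ζ.im ≤ max p.im q.im := by
  obtain ⟨ζ, hζ, h⟩ := exists_mem_segment_re_eq h1 h2
  exact ⟨ζ, segment_symm ℝ q p ▸ hζ, by rwa [min_comm, max_comm]⟩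

/-- [folklore] -/
theorem exists_mem_segment_im_eq {p q : ℂ} {s : ℝ} (h1 : p.im ≤ s) (h2 : s ≤ q.im) :
    ∃ ζ ∈ segment ℝ p q, ζ.im = s ∧ min p.re q.re ≤ ζ.re ∧ ζ.re ≤ max p.re q.re := by
  rcases eq_or_lt_of_le (h1.trans h2) with hpq | hpq
  · refine ⟨p, left_mem_segment ℝ p q, le_antisymm h1 (hpq ▸ h2), min_le_left _ _, le_max_left _ _⟩
  set l : ℝ := (s - p.im) / (q.im - p.im) with hl
  have hd : 0 < q.im - p.im := by linarith
  have hl0 : 0 ≤ l := div_nonneg (by linarith) hd.le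
  have hl1 : l ≤ 1 := div_le_one_of_le₀ (by linarith) hd.le
  refine ⟨p + l • (q - p), ⟨1 - l, l, by linarith, hl0, by ring, by
    simp only [sub_smul, one_smul, smul_sub]; abel⟩, ?_, ?_, ?_⟩
  · simp only [add_im, smul_im, sub_im, smul_eq_mul, hl]
    field_simp
    ring
  · simp only [add_re, smul_re, sub_re, smul_eq_mul]
    rcases le_total p.re q.re with h | h
    · rw [min_eq_left h]; nlinarith
    · rw [min_eq_right h]; nlinarith
  · simp only [add_re, smul_re, sub_re, smul_eq_mul]
    rcases le_total p.re q.re with h | h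
    · rw [max_eq_right h]; nlinarith
    · rw [max_eq_left h]; nlinarith

/-- [folklore] -/
theorem exists_mem_segment_im_eq' {p q : ℂ} {s : ℝ} (h1 : q.im ≤ s) (h2 : s ≤ p.im) :
    ∃ ζ ∈ segment ℝ p q, ζ.im = s ∧ min p.re q.re ≤ ζ.re ∧ ζ.re ≤ max p.re q.re := by
  obtain ⟨ζ, hζ, h⟩ := exists_mem_segment_im_eq h1 h2
  exact ⟨ζ, segment_symm ℝ q p ▸ hζ, by rwa [min_comm, max_comm]⟩

namespace ClosedWalk

variable {n : ℕ} (c : ClosedWalk n)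

/-- No jump across the vertical line `re = a + 1` at height in `[b, b + 1]`, for a point of a
segment missing the trace. [folklore] -/
theorem W_eq_of_cross_re {z w ζ : ℂ} (hzw : ∀ x ∈ segment ℝ z w, x ∉ c.trace)
    (hζ : ζ ∈ segment ℝ z w) {a b : ℤ} (hre : ζ.re = a + 1) (h1 : (b : ℝ) ≤ ζ.im)
    (h2 : ζ.im ≤ b + 1) : c.W (a + 1, b) = c.W (a, b) :=
  c.W_east_eq (mem_segment_latC_up_iff.2 ⟨by simpa using hre, h1, h2⟩) (hzw ζ hζ)

/-- No jump across the horizontal line `im = b + 1` at abscissa in `[a, a + 1]`. [folklore] -/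
theorem W_eq_of_cross_im {z w ζ : ℂ} (hzw : ∀ x ∈ segment ℝ z w, x ∉ c.trace)
    (hζ : ζ ∈ segment ℝ z w) {a b : ℤ} (him : ζ.im = b + 1) (h1 : (a : ℝ) ≤ ζ.re)
    (h2 : ζ.re ≤ a + 1) : c.W (a, b + 1) = c.W (a, b) :=
  c.W_north_eq (mem_segment_latC_right_iff.2 ⟨by simpa using him, h1, h2⟩) (hzw ζ hζ)

/-- **Local constancy of `W ∘ flFace` off the trace** (one-sided core). [folklore] -/
theorem W_flFace_eq_of_segment_core (hn : 0 < n) {z w : ℂ}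
    (hzw : ∀ x ∈ segment ℝ z w, x ∉ c.trace)
    (ha : ⌊w.re⌋ = ⌊z.re⌋ + 1 ∨ (⌊w.re⌋ = ⌊z.re⌋ ∧ ⌊z.im⌋ ≤ ⌊w.im⌋))
    (hb : ⌊z.im⌋ - 1 ≤ ⌊w.im⌋ ∧ ⌊w.im⌋ ≤ ⌊z.im⌋ + 1) :
    c.W (flFace z) = c.W (flFace w) := by
  have seg_sub : ∀ {p q : ℂ}, p ∈ segment ℝ z w → q ∈ segment ℝ z w →
      ∀ x ∈ segment ℝ p q, x ∉ c.trace := fun hp hq x hx =>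
    hzw x ((convex_segment z w).segment_subset hp hq hx)
  have hz := left_mem_segment ℝ z w
  have hw := right_mem_segment ℝ z w
  set a := ⌊z.re⌋ with ha_def
  set b := ⌊z.im⌋ with hb_def
  have hzre1 : (a : ℝ) ≤ z.re := Int.floor_le _
  have hzre2 : z.re < a + 1 := Int.lt_floor_add_one _
  have hzim1 : (b : ℝ) ≤ z.im := Int.floor_le _
  have hzim2 : z.im < b + 1 := Int.lt_floor_add_one _
  have hwre1 : ((⌊w.re⌋ : ℤ) : ℝ) ≤ w.re := Int.floor_le _
  have hwre2 : w.re < (⌊w.re⌋ : ℤ) + 1 := Int.lt_floor_add_one _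
  have hwim1 : ((⌊w.im⌋ : ℤ) : ℝ) ≤ w.im := Int.floor_le _
  have hwim2 : w.im < (⌊w.im⌋ : ℤ) + 1 := Int.lt_floor_add_one _
  simp only [flFace]
  rw [← ha_def, ← hb_def]
  -- the three possibilities for the ordinate of the second face
  have hb3 : ⌊w.im⌋ = b ∨ ⌊w.im⌋ = b + 1 ∨ ⌊w.im⌋ = b - 1 := by omega
  rcases ha with ha | ⟨ha, hab⟩
  · -- the second face is one column to the right
    rw [ha] at hwre1 hwre2 ⊢
    push_cast at hwre1 hwre2
    obtain ⟨ζ, hζ, hζre, hζ1, hζ2⟩ := exists_mem_segment_re_eq (s := a + 1) hzre2.le hwre1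
    rcases hb3 with hb' | hb' | hb' <;> rw [hb'] at hwim1 hwim2 ⊢ <;> push_cast at hwim1 hwim2
    · -- same row
      refine (c.W_eq_of_cross_re hzw hζ hζre ?_ ?_).symm
      · exact le_trans (le_min hzim1 hwim1) hζ1
      · exact hζ2.trans (max_le hzim2.le hwim2.le)
    · -- one row up
      rcases lt_trichotomy ζ.im (b + 1) with hlt | heq | hgt
      · have e1 : c.W (a + 1, b) = c.W (a, b) :=
          c.W_eq_of_cross_re hzw hζ hζre (le_trans (le_min hzim1 (by linarith)) hζ1) hlt.le
        obtain ⟨ξ, hξ, hξim, hξ1, hξ2⟩ := exists_mem_segment_im_eq (s := b + 1) hlt.le hwim1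
        have e2 : c.W (a + 1, b + 1) = c.W (a + 1, b) :=
          c.W_eq_of_cross_im (a := a + 1) (seg_sub hζ hw) hξ hξim
            (by push_cast; exact le_trans (le_min hζre.ge hwre1) hξ1)
            (by push_cast; exact hξ2.trans (max_le (by linarith) (by linarith)))
        rw [e2, e1]
      · have hu : latC (a + 1, b + 1) ∉ c.trace := by
          have : latC (a + 1, b + 1) = ζ := Complex.ext (by simp [hζre]) (by simp [heq])
          rw [this]; exact hzw ζ hζ
        obtain ⟨-, -, h3⟩ := c.W_around_eq_of_latC_not_mem hn hu
        simp only [add_sub_cancel_right] at h3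
        exact h3
      · have e1 : c.W (a + 1, b + 1) = c.W (a, b + 1) :=
          c.W_eq_of_cross_re (b := b + 1) hzw hζ hζre (by push_cast; linarith)
            (by push_cast; exact hζ2.trans (max_le (by linarith) (by linarith)))
        obtain ⟨ξ, hξ, hξim, hξ1, hξ2⟩ := exists_mem_segment_im_eq (s := b + 1) hzim2.le hgt.le
        have e2 : c.W (a, b + 1) = c.W (a, b) :=
          c.W_eq_of_cross_im (seg_sub hz hζ) hξ hξim (le_trans (le_min hzre1 (by linarith)) hξ1)
            (hξ2.trans (max_le hzre2.le hζre.le))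
        rw [e1, e2]
    · -- one row down
      rcases lt_trichotomy ζ.im b with hlt | heq | hgt
      · have e1 : c.W (a + 1, b - 1) = c.W (a, b - 1) :=
          c.W_eq_of_cross_re (b := b - 1) hzw hζ hζre
            (by push_cast; exact le_trans (le_min (by linarith) hwim1) hζ1) (by push_cast; linarith)
        obtain ⟨ξ, hξ, hξim, hξ1, hξ2⟩ := exists_mem_segment_im_eq' (s := b) hlt.le hzim1
        have e2 : c.W (a, b - 1 + 1) = c.W (a, b - 1) :=
          c.W_eq_of_cross_im (b := b - 1) (seg_sub hz hζ) hξ (by push_cast; linarith)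
            (le_trans (le_min hzre1 (by linarith)) hξ1) (hξ2.trans (max_le hzre2.le hζre.le))
        rw [sub_add_cancel] at e2
        rw [e1, ← e2]
      · have hu : latC (a + 1, b) ∉ c.trace := by
          have : latC (a + 1, b) = ζ := Complex.ext (by simp [hζre]) (by simp [heq])
          rw [this]; exact hzw ζ hζ
        obtain ⟨h1, h2, -⟩ := c.W_around_eq_of_latC_not_mem hn hu
        simp only [add_sub_cancel_right] at h1
        rw [h1]
        exact h2.symm
      · have e1 : c.W (a + 1, b) = c.W (a, b) :=
          c.W_eq_of_cross_re hzw hζ hζre hgt.le (hζ2.trans (max_le hzim2.le (by linarith)))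
        obtain ⟨ξ, hξ, hξim, hξ1, hξ2⟩ :=
          exists_mem_segment_im_eq' (s := b) (by linarith : w.im ≤ b) hgt.le
        have e2 : c.W (a + 1, b - 1 + 1) = c.W (a + 1, b - 1) :=
          c.W_eq_of_cross_im (b := b - 1) (seg_sub hζ hw) hξ (by push_cast; linarith)
            (by push_cast; exact le_trans (le_min hζre.ge hwre1) hξ1)
            (by push_cast; exact hξ2.trans (max_le (by linarith) (by linarith)))
        rw [sub_add_cancel] at e2
        rw [← e2, e1]
  · -- same column
    rw [ha] at hwre1 hwre2 ⊢
    have hb2 : ⌊w.im⌋ = b ∨ ⌊w.im⌋ = b + 1 := by omega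
    rcases hb2 with hb' | hb'
    · rw [hb']
    · rw [hb'] at hwim1 hwim2 ⊢
      push_cast at hwim1 hwim2
      obtain ⟨ξ, hξ, hξim, hξ1, hξ2⟩ := exists_mem_segment_im_eq (s := b + 1) hzim2.le hwim1
      exact (c.W_eq_of_cross_im hzw hξ hξim (le_trans (le_min hzre1 hwre1) hξ1)
        (hξ2.trans (max_le hzre2.le hwre2.le))).symm

/-- **Local constancy of `W ∘ flFace` off the trace.**  If the closed segment `[z, w]` misses
the trace of the walk and its endpoints differ by less than `1` in each coordinate, then the
faces containing `z` and `w` have the same winding number. [folklore] -/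
theorem W_flFace_eq_of_segment (hn : 0 < n) {z w : ℂ} (hzw : ∀ x ∈ segment ℝ z w, x ∉ c.trace)
    (hre : |z.re - w.re| < 1) (him : |z.im - w.im| < 1) : c.W (flFace z) = c.W (flFace w) := by
  have hwz : ∀ x ∈ segment ℝ w z, x ∉ c.trace := fun x hx => hzw x (segment_symm ℝ z w ▸ hx)
  rw [abs_lt] at hre him
  have r1 : ⌊w.re⌋ ≤ ⌊z.re⌋ + 1 := by
    rw [← Int.floor_add_one]; exact Int.floor_le_floor (by linarith)
  have r2 : ⌊z.re⌋ ≤ ⌊w.re⌋ + 1 := by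
    rw [← Int.floor_add_one]; exact Int.floor_le_floor (by linarith)
  have i1 : ⌊w.im⌋ ≤ ⌊z.im⌋ + 1 := by
    rw [← Int.floor_add_one]; exact Int.floor_le_floor (by linarith)
  have i2 : ⌊z.im⌋ ≤ ⌊w.im⌋ + 1 := by
    rw [← Int.floor_add_one]; exact Int.floor_le_floor (by linarith)
  rcases lt_trichotomy ⌊w.re⌋ ⌊z.re⌋ with h | h | h
  · exact (c.W_flFace_eq_of_segment_core hn hwz (Or.inl (by omega)) ⟨by omega, by omega⟩).symm
  · rcases le_total ⌊z.im⌋ ⌊w.im⌋ with h' | h'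
    · exact c.W_flFace_eq_of_segment_core hn hzw (Or.inr ⟨h, h'⟩) ⟨by omega, by omega⟩
    · exact (c.W_flFace_eq_of_segment_core hn hwz (Or.inr ⟨h.symm, h'⟩) ⟨by omega, by omega⟩).symm
  · exact c.W_flFace_eq_of_segment_core hn hzw (Or.inl (by omega)) ⟨by omega, by omega⟩

end ClosedWalk

/-- [folklore] -/
theorem dist_left_le_of_mem_segment {p q x : ℂ} (hx : x ∈ segment ℝ p q) : dist x p ≤ dist q p := by
  obtain ⟨a, b, ha, hb, hab, rfl⟩ := hx
  obtain rfl : a = 1 - b := eq_sub_of_add_eq hab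
  have : (1 - b) • p + b • q - p = b • (q - p) := by
    simp only [sub_smul, one_smul, smul_sub]; abel
  rw [dist_eq_norm, dist_eq_norm, this, norm_smul, Real.norm_of_nonneg hb]
  exact mul_le_of_le_one_left (norm_nonneg _) (by linarith)

namespace ClosedWalk

variable {n : ℕ} (c : ClosedWalk n)

/-- **Constancy of `W ∘ flFace` along paths missing the trace.** [folklore] -/
theorem W_flFace_eq_of_path (hn : 0 < n) {z w : ℂ} (γ : Path z w) (hγ : ∀ t, γ t ∉ c.trace) :
    c.W (flFace z) = c.W (flFace w) := by
  have hK : IsCompact (Set.range γ) := isCompact_range γ.continuous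
  obtain ⟨ρ, hρ, hthick⟩ := hK.exists_thickening_subset_open c.isClosed_trace.isOpen_compl
    (by rintro _ ⟨t, rfl⟩; exact hγ t)
  have huc : UniformContinuous γ := CompactSpace.uniformContinuous_of_continuous γ.continuous
  obtain ⟨η, hη, hηuc⟩ := Metric.uniformContinuous_iff.1 huc (min ρ (1 / 2)) (by positivity)
  obtain ⟨M, hM⟩ := exists_nat_gt (1 / η)
  have hMpos : (0 : ℝ) < M := lt_trans (by positivity) hM
  have hMη : 1 / (M : ℝ) < η := by
    rw [div_lt_iff₀ hMpos]; rw [div_lt_iff₀ hη] at hM; linarith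
  let ti : ℕ → unitInterval := fun i =>
    ⟨min ((i : ℝ) / M) 1, le_min (by positivity) zero_le_one, min_le_right _ _⟩
  have hdist : ∀ i, dist (ti (i + 1)) (ti i) < η := by
    intro i
    refine lt_of_le_of_lt ?_ hMη
    change |min (((i + 1 : ℕ) : ℝ) / M) 1 - min ((i : ℝ) / M) 1| ≤ 1 / M
    have h1 : ((i + 1 : ℕ) : ℝ) / M = (i : ℝ) / M + 1 / M := by push_cast; ring
    rw [h1, abs_le]
    have hMi : 0 ≤ 1 / (M : ℝ) := by positivity
    constructor
    · have := min_le_min_right (1 : ℝ) (show (i : ℝ) / M ≤ (i : ℝ) / M + 1 / M by linarith)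
      linarith
    · rcases le_total ((i : ℝ) / M + 1 / M) 1 with h | h
      · rw [min_eq_left h, min_eq_left (by linarith)]
        linarith
      · rw [min_eq_right h]
        rcases le_total ((i : ℝ) / M) 1 with h' | h'
        · rw [min_eq_left h']
          linarith
        · rw [min_eq_right h']
          linarith
  have step : ∀ i, c.W (flFace (γ (ti i))) = c.W (flFace (γ (ti (i + 1)))) := by
    intro i
    have hd : dist (γ (ti (i + 1))) (γ (ti i)) < min ρ (1 / 2) := hηuc (hdist i)
    have hd1 : dist (γ (ti (i + 1))) (γ (ti i)) < ρ := lt_of_lt_of_le hd (min_le_left _ _)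
    have hd2 : dist (γ (ti (i + 1))) (γ (ti i)) < 1 / 2 := lt_of_lt_of_le hd (min_le_right _ _)
    have hn' : ‖γ (ti i) - γ (ti (i + 1))‖ < 1 := by
      rw [← dist_eq_norm, dist_comm]; linarith
    refine c.W_flFace_eq_of_segment hn (fun x hx hxt => ?_) ?_ ?_
    · refine hthick ?_ hxt
      rw [mem_thickening_iff_infDist_lt ⟨_, Set.mem_range_self (ti i)⟩]
      calc infDist x (Set.range γ) ≤ dist x (γ (ti i)) := infDist_le_dist_of_mem (Set.mem_range_self _)
        _ ≤ dist (γ (ti (i + 1))) (γ (ti i)) := dist_left_le_of_mem_segment hx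
        _ < ρ := hd1
    · exact lt_of_le_of_lt (by simpa using abs_re_le_norm (γ (ti i) - γ (ti (i + 1)))) hn'
    · exact lt_of_le_of_lt (by simpa using abs_im_le_norm (γ (ti i) - γ (ti (i + 1)))) hn'
  have chain : ∀ i, c.W (flFace (γ (ti 0))) = c.W (flFace (γ (ti i))) := by
    intro i
    induction i with
    | zero => rfl
    | succ i ih => exact ih.trans (step i)
  have h0 : γ (ti 0) = z := by
    have : ti 0 = 0 := Subtype.ext (by simp [ti])
    rw [this, γ.source]
  have h1 : γ (ti M) = w := by
    have : ti M = 1 := Subtype.ext (by simp [ti, div_self hMpos.ne'])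
    rw [this, γ.target]
  have := chain M
  rwa [h0, h1] at this

/-- `W ∘ flFace` agrees at points joined by a path off the trace. [folklore] -/
theorem W_flFace_eq_of_joinedIn (hn : 0 < n) {z w : ℂ} (h : JoinedIn c.traceᶜ z w) :
    c.W (flFace z) = c.W (flFace w) := by
  obtain ⟨γ, hγ⟩ := h
  exact c.W_flFace_eq_of_path hn γ hγ

/-- Far to the left of the walk the winding number of the face containing a point vanishes. [folklore] -/
theorem W_flFace_eq_zero_of_re_lt {w : ℂ} (hw : ∀ j, w.re + 1 ≤ (c.v j).1) :
    c.W (flFace w) = 0 :=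
  c.W_eq_zero_of_lt_fst fun j => by
    have h1 : ((⌊w.re⌋ : ℤ) : ℝ) ≤ w.re := Int.floor_le _
    have h2 := hw j
    exact_mod_cast (show ((⌊w.re⌋ : ℤ) : ℝ) < (c.v j).1 by linarith)

/-- **A face whose centre is joined off the trace to a point far to the left of the walk has
winding number zero.** [folklore] -/
theorem W_eq_zero_of_joinedIn_far (hn : 0 < n) {f : ℤ × ℤ} {w : ℂ}
    (h : JoinedIn c.traceᶜ (faceCtr f) w) (hw : ∀ j, w.re + 1 ≤ (c.v j).1) : c.W f = 0 := by
  rw [← flFace_faceCtr f, c.W_flFace_eq_of_joinedIn hn h]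
  exact c.W_flFace_eq_zero_of_re_lt hw

/-- Contrapositive form: a face of non-zero winding number is not joined off the trace to any
point far to the left of the walk. [folklore] -/
theorem not_joinedIn_far_of_W_ne_zero (hn : 0 < n) {f : ℤ × ℤ} (hf : c.W f ≠ 0) {w : ℂ}
    (hw : ∀ j, w.re + 1 ≤ (c.v j).1) : ¬ JoinedIn c.traceᶜ (faceCtr f) w := fun h =>
  hf (c.W_eq_zero_of_joinedIn_far hn h hw)

end ClosedWalk

end Literature.Probability.LatticeModels
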